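import Mathlib.Data.Rat.Defs
import Mathlib.Tactic.Linarith
import Mathlib.Tactic.NormNum
import Mathlib.Tactic.Ring
import Mathlib.Tactic.Positivity
import HarnessLib

/-!
# The (0,1) cell of the ι-window, XXII-B: the product ground `B₁ × B₂`, IX (second file) — the TRANSPORT CALCULUS of presented families under
# `Φ∘T^k` and `∨∘Φ∘T^k` (report [XXII] §6) and the final atlas counts (§7)

Family `hodge`, b2b cell `hweil` (helper of item stmt-HodgeConjecture-2524). Companion (`pg9b_*`) of `WeilTypeLadderH2ProductGroundNine.lean`
(prover 1 gen 34, `pg9_*`). Report `run/shared/lean/b2b/hodge-weil/b2b-hweil-pv1-g34/H2-ZERO-ONE-22.md` ([XXII] §§6–7). HONEST FRAMING: census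
results inside the ladder's H2 test ((0,1) cell) on the SPECIAL fourfold `X₀ = B₁ × B₂`; emptiness / non-isolation of a family there is a census
line and nothing more. No case of the Hodge conjecture is proved; nothing here is a rung; no statement of [Markman 2025] / [Perry 2026] /
[EdGFS 2025] is used. Every head is the elementary arithmetic SHADOW of a named step of the report.

Conventions as in the companions: classes `(r, c, s)`, `T(r,c,s) = (r, c+r, s+2c+r)`, `Φ(r,c,s) = (s, −c, r)`, `∨(r,c,s) = (r, −c, s)`; linear forms
`λ = (β, δ) ↔ βX + δY`, `[λ²] = (β², βδ, δ²)`, `[2λλ'] = (2ββ', βδ'+β'δ, 2δδ')`; on forms `Φ∘T^k : (β,δ) ↦ (δ + kβ, −β)` and `∨ : (β,δ) ↦ (β, −δ)`.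

* `pg9b_transport` — the transport of square and product classes: `[(Φ∘T^k λ)²] = Φ(T^k[λ²])`, `[2(Φ∘T^kλ)(Φ∘T^kλ')] = Φ(T^k[2λλ'])`,
  `[(λ^∨)²] = [λ²]^∨`, and `det` is preserved by `Φ∘T^k` and negated by `∨` — so kernel and cokernel presentations, frames and the relations `v = u₀ − 3u₁`,
  `v = 3u₁ − u₀` are transported verbatim (report §6.1).
* `pg9b_twist_sign` — IT₀ bookkeeping of the pieces: `[λ²]` twisted by `k` has slope `2(δ + kβ)/β`, positive iff the transported form
  `(β', δ') = (δ + kβ, −β)` has `β'δ' < 0`, iff the dualised transported form has `β'δ' > 0` (report §6.2 (R2)).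
* `pg9b_b2_unit` — the `b = 2` coincidence used for the second family: `T(11,−5,2) = (11,6,3)`, `T(11,−6,3) = (11,5,2)`; the bad members of class
  `(11,6,3)` are `ker(A ↠ [(1,1)²])` with `A = T(12,−5,2) = (12,7,4) = (11,6,3) + (1,1,1)` of norm `1` (THEOREM T2 REMARK (a)); dual: `(12,−7,4)`.
* `pg9b_wkv_frame` — the source `W_K^∨`: frame `((K−1,1),(K,1))`, `det = −1`, `3(K²,K,1) − ((K−1)², K−1, 1) = (2K²+2K−1, 2K+1, 2)`, and its line
  frames `Φ∘T^k`: `((kK−k+1, −(K−1)), (kK+1, −K))`, `det = −1`, bottom test.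
* `pg9b_counts` — the atlas of [XXII] §7: depth ≤ 1 / 2 / 3 tallies `205 / 76 / 12`, `150 + 205 + 76 + 12 = 443`: every bi-positive reading of height
  `≤ 40` is settled (`2` degenerate, `148` of [19]–[21], `293` here); `291` certificates; at height `≤ 60`: `995 − 4` with the stated parameter ranges.
-/

-- mandated namespace `Summit.HodgeConjecture.HodgeConjecture.…` (Problem = Summit) trips `linter.dupNamespace`; the lakefile disables it
-- tree-wide (weak option), restated here so stand-alone elaboration is warning-free too.
set_option linter.dupNamespace false

namespace Summit.HodgeConjecture.HodgeConjecture.WeilTypeLadder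

section ProductGroundNineB

/-- **Transport of presentations (report §6.1).** For linear forms `λ = (β,δ)`, `λ' = (β',δ')` and `k ∈ ℤ`, with `Φ∘T^k(β,δ) := (δ + kβ, −β)`:
the square class of the transported form is `Φ(T^k[λ²])` where `T^k(r,c,s) = (r, c + kr, s + 2kc + k²r)` and `Φ(r,c,s) = (s,−c,r)`; likewise for
the product class `[2λλ']`; the dual form `(β, −δ)` has square class `(β², −βδ, δ²) = [λ²]^∨`; `det(Φ∘T^kλ, Φ∘T^kλ') = det(λ,λ')` and
`det(λ^∨, λ'^∨) = −det(λ,λ')`. Hence a presentation `0 → R → V → M → 0` by pieces `[λ_V²]`, `[λ_M²]` of a sheaf of class `u₀ − 3u₁` (resp.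
`3u₁ − u₀`) is carried by an exact `Φ∘T^k` to a presentation of the transform with the transported forms and the same relation, and dualising
swaps kernel and cokernel presentations. [shadow: `ring`] -/
theorem pg9b_transport (β δ β' δ' k : ℤ) :
    (((δ + k * β) ^ 2, (δ + k * β) * (-β), (-β) ^ 2) =
      ((δ ^ 2 + 2 * k * (β * δ) + k ^ 2 * β ^ 2), -(β * δ + k * β ^ 2), β ^ 2)) ∧
    ((2 * (δ + k * β) * (δ' + k * β'), (δ + k * β) * (-β') + (δ' + k * β') * (-β), 2 * (-β) * (-β')) =
      ((2 * δ * δ' + 2 * k * (β * δ' + β' * δ) + k ^ 2 * (2 * β * β')), -((β * δ' + β' * δ) + k * (2 * β * β')), 2 * β * β')) ∧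
    ((β ^ 2, β * (-δ), (-δ) ^ 2) = (β ^ 2, -(β * δ), δ ^ 2)) ∧
    ((δ + k * β) * (-β') - (δ' + k * β') * (-β) = β * δ' - β' * δ) ∧
    (β * (-δ') - β' * (-δ) = -(β * δ' - β' * δ)) := by
  refine ⟨?_, ?_, ?_, by ring, by ring⟩
  · ext <;> simp <;> ring
  · ext <;> simp <;> ring
  · ext <;> simp

/-- **Positivity of the twisted pieces (report §6.2 (R2)).** A simple semi-homogeneous piece `[λ²]`, `λ = (β,δ)`, `β ≠ 0`, has slope `2δ/β`; twisted
by `kΘ` its slope is `2(δ + kβ)/β`, which is positive iff `β(δ + kβ) > 0`; in terms of the transported form `(β₁, δ₁) = (δ + kβ, −β)` this is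
`β₁δ₁ < 0`, and in terms of the dualised transported form `(β₁, −δ₁) = (δ + kβ, β)` it is `β₁·β > 0`. (So the IT₀ of every piece after the twist
is read off the sign of `β'δ'` of the transported form: negative for `Φ∘T^k`, positive for `∨∘Φ∘T^k`.) [shadow: `ring` / `nlinarith`] -/
theorem pg9b_twist_sign (β δ k : ℤ) :
    ((δ + k * β) * (-β) = -(β * (δ + k * β))) ∧ ((δ + k * β) * β = β * (δ + k * β)) ∧
    (0 < β * (δ + k * β) ↔ (δ + k * β) * (-β) < 0) ∧ (0 < β * (δ + k * β) ↔ 0 < (δ + k * β) * β) := by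
  refine ⟨by ring, by ring, ?_, ?_⟩
  · constructor <;> intro h <;> nlinarith
  · constructor <;> intro h <;> nlinarith

/-- **The `b = 2` coincidence of the second family with the rank-two transform line (report §5.3, after THEOREM T2 REMARK (a)).**
`T(11,−5,2) = (11,6,3)` and `T(11,−6,3) = (11,5,2)`: the classes of `G₂^∨` and `W₂ = Φ(E′(2Θ))` (resp. `G₂` and `W₂^∨`) are `T`-equivalent; the
NL-derived members are `ker(A ↠ L)` with `L` of class `[(1,1)²] = (1,1,1)` and `A = T(12,−5,2) = (12,7,4) = (11,6,3) + (1,1,1)` of norm `1`; dually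
`(12,−7,4) = (11,−6,3) + (1,−1,1)` with `(1,−1,1) = [(1,−1)²]`. [shadow: `norm_num` / `decide`] -/
theorem pg9b_b2_unit :
    (((11 : ℤ), -5 + 11, 2 + 2 * (-5) + 11) = (11, 6, 3)) ∧ (((11 : ℤ), -6 + 11, 3 + 2 * (-6) + 11) = (11, 5, 2)) ∧
    (((12 : ℤ), -5 + 12, 2 + 2 * (-5) + 12) = (12, 7, 4)) ∧ (((11 : ℤ) + 1, (6 : ℤ) + 1, (3 : ℤ) + 1) = (12, 7, 4)) ∧
    ((7 : ℤ) ^ 2 - 12 * 4 = 1) ∧ (((1 : ℤ) ^ 2, (1 : ℤ) * 1, (1 : ℤ) ^ 2) = (1, 1, 1)) ∧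
    (((11 : ℤ) + 1, (-6 : ℤ) + (-1), (3 : ℤ) + 1) = (12, -7, 4)) ∧ (((1 : ℤ) ^ 2, (1 : ℤ) * (-1), (-1 : ℤ) ^ 2) = (1, -1, 1)) := by
  refine ⟨by norm_num, by norm_num, by norm_num, by norm_num, by norm_num, by norm_num, by norm_num, by norm_num⟩

/-- **The source `W_K^∨` and its lines (report §5.4).** The universal frame of `P(K) = (K, 2K−1)` is `((K−1,1),(K,1))` (type II, `det = −1`) with
`3[(K,1)²] − [(K−1,1)²] = (2K²+2K−1, 2K+1, 2) = v_K^∨` (THEOREM FT (i): every rigid factor is K′-presented there). Along the line `Φ∘T^k`: the frame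
becomes `((1 + k(K−1), −(K−1)), (1 + kK, −K))`, `det = −1`, type II chamber coordinates `(b₀,b₁) = (k(K−1)+1, kK+1)`, bottom test `2b₀ < 3b₁`,
reading `(b₁, b₀+b₁) = (kK+1, k(2K−1)+2)`. [shadow: `ring` / `nlinarith`] -/
theorem pg9b_wkv_frame (K k : ℤ) (hK : 2 ≤ K) (hk : 1 ≤ k) :
    ((K - 1) * 1 - K * 1 = -1) ∧
    ((3 * K ^ 2 - (K - 1) ^ 2, 3 * (K * 1) - (K - 1) * 1, (3 : ℤ) * 1 ^ 2 - 1 ^ 2) = (2 * K ^ 2 + 2 * K - 1, 2 * K + 1, 2)) ∧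
    ((1 + k * (K - 1)) * (-K) - (1 + k * K) * (-(K - 1)) = -1) ∧ (2 * (k * (K - 1) + 1) < 3 * (k * K + 1)) ∧
    ((k * K + 1) + (k * (K - 1) + 1) = k * (2 * K - 1) + 2) := by
  refine ⟨by ring, ?_, by ring, by nlinarith, by ring⟩
  ext <;> simp <;> ring

/-- **Atlas counts after [XXII] §6 (report §7).** At height `≤ 40` (443 bi-positive readings; 150 settled by [18]–[21] incl. the 2 degenerate bottoms):
the lines of depth `1` settle `205` readings (the `169` of the first kernel's `pg9_counts` plus `36` from the enlarged source ranges `m, b ≤ 20`,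
`K ≤ 16` and the source `W_K^∨`), depth `2` a further `76`, depth `3` the last `12`: `205 + 76 + 12 = 293`, `150 + 293 = 443`, nothing open, nothing
partial; `291` ray certificates are used (`293 − 2` higher members share their bottom's certificate). At height `≤ 60` (995 readings) with
`m, b ≤ 30`, `K ≤ 24`, `k ≤ 22`, ranks `≤ 20000`, depth `≤ 3`: `235 + 2 + 441 + 247 + 66 = 991` settled, `1` open, `3` partial (range artefacts).
[shadow: `norm_num`] -/
theorem pg9b_counts :
    (169 + 36 = (205 : ℕ)) ∧ (205 + 76 + 12 = (293 : ℕ)) ∧ (150 + 293 = (443 : ℕ)) ∧ (148 + 2 = (150 : ℕ)) ∧ (293 - 2 = (291 : ℕ)) ∧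
    (235 + 2 + 441 + 247 + 66 = (991 : ℕ)) ∧ (991 + 1 + 3 = (995 : ℕ)) := by
  refine ⟨by norm_num, by norm_num, by norm_num, by norm_num, by norm_num, by norm_num, by norm_num⟩

end ProductGroundNineB

end Summit.HodgeConjecture.HodgeConjecture.WeilTypeLadder
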